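import Literature.NumberTheory.EllipticCurves.Kato2004.IwasawaCohomologyUniqueProofs
import Literature.NumberTheory.GaloisRepresentations.ContinuousCorestrictionResNormal
import Literature.NumberTheory.EllipticCurves.IwasawaTowerTorsionFiniteProofs
import HarnessLib

/-!
# The layers `Γ_n = Gal(ℚ̄/ℚ_n)` of a `ℤ_p`-extension of `ℚ` with topological generator `γ`:
# `res ∘ Cor` is the norm `Σ_{i<p^k} conj_{γ^{p^n i}}`; on Kato's pin `𝐇¹_Γ(T_pW)` the restriction of a
# norm-compatible family up the tower is `proj (n+k) (ν_{n,k} • y)`; an inflation–restriction bound;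
# a uniform exponent killing `W[p^k]^{Γ_m}`

Topic `NumberTheory/EllipticCurves`, sub-directory `Kato2004` (namespace = path, helper namespace
`IwasawaH1LayerNorm`).  THEOREMS ONLY (no definition, no named fact, no `sorry`, no instance, no
notation).  Cell `bsd-potss` (seat `bsd-potss-rkm` g7): the cohomological plumbing of the
Shapiro-free proof of Kato, Astérisque 295, Thm. 12.4 (2) "`𝐇¹(T)` is a torsion free `Λ`-module" on
the pin `Kato2004.IwasawaH1Data W p κ γ` (file `Kato2004/IwasawaH1LambdaTorsionFreeProofs.lean`).

* §B (layers, `κ : ZpExtension ℚ p`, `κ γ = 1`): `toAdd_apply_pow`, **`pow_mem_layerSubgroup_iff`**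
  (`γ^N ∈ Γ_n ↔ p^n ∣ N`), `pow_inv_mul_pow_mem_layerSubgroup_iff`, `card_layerQuotient`
  (`#(Γ_n/Γ_{n+k}) = p^k`), **`bijective_powCoset`** (`i ↦ γ^{p^n i}`, `i < p^k`, enumerates
  `Γ_n/Γ_{n+k}`), **`resLe_coresLe_layer_eq_sum`**: for ANY topological representation `X` of `Γ_ℚ`,
  `res_{Γ_n→Γ_{n+k}} (Cor_{Γ_{n+k}→Γ_n} ξ) = Σ_{i<p^k} γ^{p^n i} · ξ` on `H¹(Γ_{n+k}, X)` (the tree's normal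
  double-coset formula `resLe_coresLe_eq_sum_conjMap` with these representatives).
* §C (the pin `I : IwasawaH1Data W p κ γ`): `coresLe_proj_eq_proj` (iterated trace maps,
  `Cor_{ℚ_{n'}→ℚ_n} proj n' = proj n`), `proj_one_add_X_pow_smul` (`(1+X)^N ∈ Λ` acts as `conj_{γ^N}`),
  **`resLe_proj_eq_proj_sum_smul`**: `res_{Γ_n→Γ_{n+k}} (proj n y) = proj (n+k) (ν_{n,k} • y)` with
  `ν_{n,k} = Σ_{i<p^k} ((1+X)^{p^n})^i` — the Λ-adic form of "`res ∘ Cor` = norm".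
* §D **`smul_eq_zero_of_resLe_eq_zero`** (general `TopRep X` of a topological group `G` with continuous
  orbit maps, `N ⊴ G`, `N ≤ U`): a class in `H¹(U, X)` whose restriction to `N` vanishes is killed by
  every scalar killing the `N`-fixed vectors `X^N` — the inflation–restriction sequence
  `0 → H¹(U/N, X^N) → H¹(U, X) → H¹(N, X)` in annihilator form, proved on cocycles (`φ|_N = ∂v`,
  `ψ = φ − ∂v` vanishes on `N`, its values are `N`-fixed by the cocycle identity and normality).
  **`exists_pow_smul_eq_zero_of_forall_smul_eq`**: ONE exponent `c` with `p^c · v = 0` for every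
  `v ∈ W[p^k]` fixed by `Γ_m`, all `k`, `m` — every such `v` lies in the finite group
  `E[p^∞]^{Gal(ℚ̄/ℚ_∞)}` (`WeierstrassCurve.finite_fixedPoints_kerSubgroup_geomPrimaryTorsion_rat`,
  Greenberg LNM 1716 §1; tree, every `E/ℚ`, `p`, `κ`).

## References

* [Kato2004Asterisque] K. Kato, Astérisque 295 (2004), §12.2 (p. 220) ("inverse limit … with respect
  to trace maps"), §13.8 (pp. 228–229).
* [NeukirchSchmidtWingberg2008] J. Neukirch, A. Schmidt, K. Wingberg, *Cohomology of Number Fields*,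
  2nd ed. (2008), I §5 Prop. 1.5.3, (1.5.6)–(1.5.7); (1.6.7) (inflation–restriction).
* [SerreGaloisCohomology1997] J.-P. Serre, *Galois Cohomology* (1997), I §2.2, I §2.6 (b).
* [Washington1997] L. C. Washington, *Introduction to Cyclotomic Fields* (1997), §13.1 (`Γ_n`,
  `[Γ : Γ_n] = p^n`).
* [GreenbergLNM1716] R. Greenberg, LNM 1716 (1999), §1 p. 62, §3 p. 86.
* Tree: `Kato2004/IwasawaCohomology.lean` (`IwasawaH1Data`, `layerCores`),
  `Kato2004/IwasawaCohomologyUniqueProofs.lean` (`proj_coe_smul`),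
  `GaloisRepresentations/ContinuousCorestriction{,Comp,RelConj,ResNormal}.lean` (`resLe`, `coresLe`,
  `conjMap`, `coresLe_comp`, `conjMap_toLinearMap_pow_apply`, `resLe_coresLe_eq_sum_conjMap`),
  `EllipticCurves/IwasawaTowerTorsionFiniteProofs.lean`, `EllipticCurves/ZpExtension.lean`.
-/

noncomputable section

open scoped NumberField
open Field CategoryTheory
open Literature.NumberTheory.GaloisRepresentations
open Literature.NumberTheory.EllipticCurves Literature.NumberTheory.EllipticCurves.Kato2004
open Literature.NumberTheory.EllipticCurves.Kato2004.EulerSystemValues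
open WeierstrassCurve (geomPoints geomTorsion geomPrimaryTorsion)

universe u v

namespace Literature.NumberTheory.EllipticCurves.Kato2004

namespace IwasawaH1LayerNorm

variable (p : ℕ) [hp : Fact p.Prime]

/-! ## §B The layers `Γ_n = Gal(ℚ̄/ℚ_n)` of a `ℤ_p`-extension with topological generator `γ`:
`γ^{p^n i}` (`i < p^k`) enumerate `Γ_n / Γ_{n+k}`; `res ∘ cor = Σ_{i<p^k} conj_{γ^{p^n i}}`;
iterated trace maps -/

section Layers

variable {p} (κ : ZpExtension ℚ p) {γ : absoluteGaloisGroup ℚ}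

/-- `κ(γ^N) = N` (additively) for a topological generator `γ` (`κ γ = 1`).
[cite: Washington1997, §13.1] -/
theorem toAdd_apply_pow (hγ : κ.IsTopGenerator γ) (N : ℕ) : (κ (γ ^ N)).toAdd = (N : ℤ_[p]) := by
  have hγ' : κ γ = Multiplicative.ofAdd 1 := hγ
  rw [map_pow, hγ', ← ofAdd_nsmul, toAdd_ofAdd, nsmul_eq_mul, mul_one]

/-- **`γ^N ∈ Γ_n ↔ p^n ∣ N`** for a topological generator `γ` (`Γ_n = κ⁻¹(p^n ℤ_p)`).
[cite: Washington1997, §13.1] -/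
theorem pow_mem_layerSubgroup_iff (hγ : κ.IsTopGenerator γ) (n N : ℕ) :
    γ ^ N ∈ κ.layerSubgroup n ↔ p ^ n ∣ N := by
  have hN : (N : ℤ_[p]) = ((N : ℤ) : ℤ_[p]) := (Int.cast_natCast N).symm
  rw [ZpExtension.mem_layerSubgroup, toAdd_apply_pow κ hγ, hN, PadicInt.pow_p_dvd_int_iff,
    ← Nat.cast_pow, Int.natCast_dvd_natCast]

/-- `(γ^a)⁻¹ γ^b ∈ Γ_m` with `a ≤ b` iff `p^m ∣ b − a` (`Γ_m = κ⁻¹(p^m ℤ_p)`, `κ γ = 1`).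
[cite: Washington1997, §13.1] -/
theorem pow_inv_mul_pow_mem_layerSubgroup_iff (hγ : κ.IsTopGenerator γ) (m : ℕ) {a b : ℕ}
    (hab : a ≤ b) : (γ ^ a)⁻¹ * γ ^ b ∈ κ.layerSubgroup m ↔ p ^ m ∣ b - a := by
  have h : (γ ^ a)⁻¹ * γ ^ b = γ ^ (b - a) := by
    rw [inv_mul_eq_iff_eq_mul, ← pow_add, Nat.add_sub_cancel' hab]
  rw [h, pow_mem_layerSubgroup_iff κ hγ]

/-- `Γ_n / Γ_{n+k}` has `p^k` elements (`[Γ_ℚ : Γ_m] = p^m`, `ZpExtension.index_layerSubgroup`).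
[cite: Washington1997, §13.1] -/
theorem card_layerQuotient (n k : ℕ)
    [Fintype (κ.layerSubgroup n ⧸ (κ.layerSubgroup (n + k)).subgroupOf (κ.layerSubgroup n))] :
    Fintype.card (κ.layerSubgroup n ⧸ (κ.layerSubgroup (n + k)).subgroupOf (κ.layerSubgroup n)) =
      p ^ k := by
  have h1 := Subgroup.relIndex_mul_index (κ.layerSubgroup_antitone (Nat.le_add_right n k))
  rw [ZpExtension.index_layerSubgroup, ZpExtension.index_layerSubgroup, pow_add,
    mul_comm (p ^ n) (p ^ k)] at h1
  rw [← Nat.card_eq_fintype_card]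
  exact Nat.eq_of_mul_eq_mul_right (pow_pos hp.out.pos n) h1

/-- **`i ↦ γ^{p^n i} Γ_{n+k}`, `i < p^k`, is a bijection onto `Γ_n / Γ_{n+k}`** (the cyclic group
`Γ_n/Γ_{n+k} ≅ ℤ/p^k` is generated by the image of `γ^{p^n}`). [cite: Washington1997, §13.1] -/
theorem bijective_powCoset (hγ : κ.IsTopGenerator γ) (n k : ℕ)
    [Fintype (κ.layerSubgroup n ⧸ (κ.layerSubgroup (n + k)).subgroupOf (κ.layerSubgroup n))] :
    Function.Bijective fun i : Fin (p ^ k) =>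
      ((⟨γ ^ (p ^ n * (i : ℕ)), (pow_mem_layerSubgroup_iff κ hγ n _).mpr (dvd_mul_right _ _)⟩ :
          κ.layerSubgroup n) :
        κ.layerSubgroup n ⧸ (κ.layerSubgroup (n + k)).subgroupOf (κ.layerSubgroup n)) := by
  rw [Fintype.bijective_iff_injective_and_card, Fintype.card_fin, card_layerQuotient κ n k]
  refine ⟨fun i i' h => ?_, rfl⟩
  have hmem := Subgroup.mem_subgroupOf.mp (QuotientGroup.eq.mp h)
  simp only [Subgroup.coe_mul, Subgroup.coe_inv] at hmem
  -- `hmem : (γ^{p^n i})⁻¹ * γ^{p^n i'} ∈ Γ_{n+k}`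
  apply Fin.ext
  rcases le_total (i : ℕ) (i' : ℕ) with hle | hle
  · have hdvd := (pow_inv_mul_pow_mem_layerSubgroup_iff κ hγ (n + k)
      (Nat.mul_le_mul_left _ hle)).mp hmem
    rw [← Nat.mul_sub, pow_add, Nat.mul_dvd_mul_iff_left (pow_pos hp.out.pos n)] at hdvd
    have hlt : (i' : ℕ) - i < p ^ k := lt_of_le_of_lt (Nat.sub_le _ _) i'.2
    have h0 := Nat.eq_zero_of_dvd_of_lt hdvd hlt
    omega
  · have hmem' := (κ.layerSubgroup (n + k)).inv_mem hmem
    rw [mul_inv_rev, inv_inv] at hmem'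
    have hdvd := (pow_inv_mul_pow_mem_layerSubgroup_iff κ hγ (n + k)
      (Nat.mul_le_mul_left _ hle)).mp hmem'
    rw [← Nat.mul_sub, pow_add, Nat.mul_dvd_mul_iff_left (pow_pos hp.out.pos n)] at hdvd
    have hlt : (i : ℕ) - i' < p ^ k := lt_of_le_of_lt (Nat.sub_le _ _) i.2
    have h0 := Nat.eq_zero_of_dvd_of_lt hdvd hlt
    omega

variable {R : Type u} [Ring R] [TopologicalSpace R] (X : TopRep.{0} R (absoluteGaloisGroup ℚ))

/-- **`res ∘ cor` along the layers is the norm `Σ_{i<p^k} conj_{γ^{p^n i}}`**: for every topological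
representation `X` of `Γ_ℚ` and `ξ ∈ H¹(Γ_{n+k}, X)`,
`res_{Γ_n → Γ_{n+k}} (cor_{Γ_{n+k} → Γ_n} ξ) = Σ_{i<p^k} γ^{p^n i} · ξ` (the normal case of the double
coset formula, `resLe_coresLe_eq_sum_conjMap`, with the representatives `γ^{p^n i}`).
[cite: NeukirchSchmidtWingberg2008, I §5 (1.5.6)–(1.5.7)] [cite: Washington1997, §13.1] -/
theorem resLe_coresLe_layer_eq_sum (hγ : κ.IsTopGenerator γ) (n k : ℕ)
    [Fintype (κ.layerSubgroup n ⧸ (κ.layerSubgroup (n + k)).subgroupOf (κ.layerSubgroup n))]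
    (ξ : continuousCohomology 1 (subgroupRep X (κ.layerSubgroup (n + k)))) :
    resLe X (κ.layerSubgroup_antitone (Nat.le_add_right n k)) 1
        (coresLe X (κ.layerSubgroup_antitone (Nat.le_add_right n k))
          (κ.isOpen_layerSubgroup (n + k)) ξ) =
      (Finset.range (p ^ k)).sum fun i =>
        conjMap X (κ.layerSubgroup (n + k)) (γ ^ (p ^ n * i)) 1 ξ := by
  classical
  have hs : ∀ x : κ.layerSubgroup n ⧸ (κ.layerSubgroup (n + k)).subgroupOf (κ.layerSubgroup n),
      ((Quotient.out x : κ.layerSubgroup n) :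
        κ.layerSubgroup n ⧸ (κ.layerSubgroup (n + k)).subgroupOf (κ.layerSubgroup n)) = x :=
    fun x => QuotientGroup.out_eq' x
  rw [resLe_coresLe_eq_sum_conjMap X (κ.layerSubgroup_antitone (Nat.le_add_right n k))
    (κ.isOpen_layerSubgroup (n + k)) hs ξ,
    ← (bijective_powCoset κ hγ n k).sum_comp
      (fun x => conjMap X (κ.layerSubgroup (n + k))
        ((Quotient.out x : κ.layerSubgroup n) : absoluteGaloisGroup ℚ) 1 ξ),
    Finset.sum_range (fun i => conjMap X (κ.layerSubgroup (n + k)) (γ ^ (p ^ n * i)) 1 ξ)]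
  refine Finset.sum_congr rfl fun i _ => ?_
  apply conjMap_apply_one_eq_of_inv_mul_mem
  have h := Subgroup.mem_subgroupOf.mp (QuotientGroup.eq.mp (hs
    ((⟨γ ^ (p ^ n * (i : ℕ)), (pow_mem_layerSubgroup_iff κ hγ n _).mpr (dvd_mul_right _ _)⟩ :
        κ.layerSubgroup n) :
      κ.layerSubgroup n ⧸ (κ.layerSubgroup (n + k)).subgroupOf (κ.layerSubgroup n))).symm)
  simpa only [Subgroup.coe_mul, Subgroup.coe_inv] using h

end Layers

/-! ## §C Iterated trace maps and the levelwise `Λ`-action on the pin -/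

section Pin

variable {p}
variable {W : WeierstrassCurve ℚ} [W.IsElliptic] [ContinuousSMul ℤ_[p] (W.tateModule p)]
  {κ : ZpExtension ℚ p} {γ : absoluteGaloisGroup ℚ} (I : IwasawaH1Data W p κ γ)

/-- **Iterated trace compatibility on the pin**: `Cor_{ℚ_{n'} → ℚ_n} (proj n' y) = proj n y` for
`n < n'` (transitivity of corestriction, `coresLe_comp`), for any finiteness structure on
`Γ_n / Γ_{n'}`. [cite: Kato2004Asterisque, §12.2 (p. 220)] [cite: NeukirchSchmidtWingberg2008, Prop. 1.5.3] -/
theorem coresLe_proj_eq_proj (y : I.H) {n n' : ℕ} (h : n < n')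
    [hF : Fintype (κ.layerSubgroup n ⧸ (κ.layerSubgroup n').subgroupOf (κ.layerSubgroup n))] :
    coresLe (tateRep W p).toTopRep (κ.layerSubgroup_antitone h.le) (κ.isOpen_layerSubgroup n')
      (I.proj n' y) = I.proj n y := by
  have hfin : ∀ m : ℕ, (κ.layerSubgroup m).FiniteIndex := fun m =>
    ⟨by rw [κ.index_layerSubgroup m]; exact pow_ne_zero _ hp.out.ne_zero⟩
  obtain ⟨k, rfl⟩ := Nat.exists_eq_add_of_lt h
  induction k generalizing hF with
  | zero =>
    have h1 := I.cores_proj n y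
    unfold layerCores at h1
    convert h1 using 3
  | succ k ih =>
    haveI := hfin
    haveI hF1 : Fintype (κ.layerSubgroup n ⧸
        (κ.layerSubgroup (n + k + 1)).subgroupOf (κ.layerSubgroup n)) := Fintype.ofFinite _
    haveI hF2 : Fintype (κ.layerSubgroup (n + k + 1) ⧸
        (κ.layerSubgroup (n + (k + 1) + 1)).subgroupOf (κ.layerSubgroup (n + k + 1))) :=
      Fintype.ofFinite _
    have hstep : coresLe (tateRep W p).toTopRep (κ.layerSubgroup_antitone (Nat.le_succ (n + k + 1)))
        (κ.isOpen_layerSubgroup (n + (k + 1) + 1)) (I.proj (n + (k + 1) + 1) y) =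
          I.proj (n + k + 1) y := by
      have h1 := I.cores_proj (n + k + 1) y
      unfold layerCores at h1
      convert h1 using 3 <;> rfl
    have hcomp := congrArg (fun f => f (I.proj (n + (k + 1) + 1) y))
      (coresLe_comp (tateRep W p).toTopRep (H := κ.layerSubgroup (n + (k + 1) + 1))
        (H' := κ.layerSubgroup (n + k + 1)) (H'' := κ.layerSubgroup n)
        (κ.layerSubgroup_antitone (Nat.le_succ (n + k + 1)))
        (κ.layerSubgroup_antitone (Nat.lt_add_of_pos_right k.succ_pos).le)
        (κ.isOpen_layerSubgroup _) (κ.isOpen_layerSubgroup _))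
    simp only [LinearMap.coe_comp, Function.comp_apply] at hcomp
    rw [hstep, ih (Nat.lt_add_of_pos_right k.succ_pos)] at hcomp
    convert hcomp.symm using 3

open Polynomial in
/-- **Powers of `1 + X ∈ Λ` act as powers of `conj_γ`**: `proj m ((1+X)^N • y) = γ^N · proj m y`
(`X` acts as `conj_γ − 1`, `proj_coe_smul`; `conjMap` is an action, `conjMap_toLinearMap_pow_apply`).
[cite: Kato2004Asterisque, §12.2 (p. 220)] -/
theorem proj_one_add_X_pow_smul (m N : ℕ) (y : I.H) :
    I.proj m (((1 + PowerSeries.X : PowerSeries ℤ_[p]) ^ N) • y) =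
      conjMap (tateRep W p).toTopRep (κ.layerSubgroup m) (γ ^ N) 1 (I.proj m y) := by
  have hcoe : ((1 + PowerSeries.X : PowerSeries ℤ_[p]) ^ N) =
      (((1 + X : ℤ_[p][X]) ^ N : ℤ_[p][X]) : PowerSeries ℤ_[p]) := by
    rw [Polynomial.coe_pow, Polynomial.coe_add, Polynomial.coe_one, Polynomial.coe_X]
  rw [hcoe, I.proj_coe_smul, map_pow, map_add, map_one, aeval_X, add_sub_cancel,
    conjMap_toLinearMap_pow_apply]

/-- **The restriction of a norm-compatible family up the tower is a norm**:
`res_{Γ_n → Γ_{n+k}} (proj n y) = proj (n+k) (ν_{n,k} • y)` with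
`ν_{n,k} = Σ_{i<p^k} ((1+X)^{p^n})^i ∈ Λ` (`proj n y = Cor proj (n+k) y`, `res ∘ Cor = Σ conj_{γ^{p^n i}}`,
and `(1+X)^{p^n i}` acts as `conj_{γ^{p^n i}}`). [cite: Kato2004Asterisque, §12.2 (p. 220) and §13.8 (p. 228)]
[cite: NeukirchSchmidtWingberg2008, I §5 (1.5.7)] -/
theorem resLe_proj_eq_proj_sum_smul (hγ : κ.IsTopGenerator γ) (n k : ℕ) (y : I.H) :
    resLe (tateRep W p).toTopRep (κ.layerSubgroup_antitone (Nat.le_add_right n k)) 1 (I.proj n y) =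
      I.proj (n + k) (((Finset.range (p ^ k)).sum fun i =>
        ((1 + PowerSeries.X : PowerSeries ℤ_[p]) ^ p ^ n) ^ i) • y) := by
  haveI : (κ.layerSubgroup (n + k)).FiniteIndex :=
    ⟨by rw [κ.index_layerSubgroup (n + k)]; exact pow_ne_zero _ hp.out.ne_zero⟩
  haveI : Fintype (κ.layerSubgroup n ⧸ (κ.layerSubgroup (n + k)).subgroupOf (κ.layerSubgroup n)) :=
    Fintype.ofFinite _
  rcases Nat.eq_zero_or_pos k with rfl | hk
  · -- `k = 0`: `res` along `Γ_n ≤ Γ_n` is the identity, `ν = 1`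
    obtain ⟨φ, hφ⟩ := oneCocycleClass_surjective _ (I.proj n y)
    simp only [pow_zero, Finset.range_one, Finset.sum_singleton, one_smul]
    change resLe (tateRep W p).toTopRep le_rfl 1 (I.proj n y) = I.proj n y
    rw [← hφ, resLe_oneCocycleClass]
    congr 1
  · rw [← coresLe_proj_eq_proj I y (Nat.lt_add_of_pos_right hk),
      resLe_coresLe_layer_eq_sum κ (tateRep W p).toTopRep hγ n k, Finset.sum_smul, map_sum]
    refine Finset.sum_congr rfl fun i _ => ?_
    rw [← pow_mul, proj_one_add_X_pow_smul I]

end Pin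

/-! ## §D Two cohomological bounds: inflation–restriction for a class dying on a normal subgroup,
and a uniform exponent killing the fixed torsion `W[p^k]^{Γ_m}` -/

section InfRes

variable {R : Type u} [Ring R] [TopologicalSpace R]
variable {G : Type v} [Group G] [TopologicalSpace G] [IsTopologicalGroup G]
variable (X : TopRep.{v} R G)

/-- **Inflation–restriction bound.** Let `N ≤ U` be subgroups of `G` with `N` normal in `G`, `X` a
topological representation of `G` with continuous orbit maps, and `C` a scalar killing the
`N`-fixed vectors of `X`. A class `ξ ∈ H¹(U, X)` with `res_{U → N} ξ = 0` satisfies `C • ξ = 0`: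
on cocycles, `φ|_N = ∂v`; then `ψ = φ − ∂v` vanishes on `N`, so by the cocycle identity and the
normality of `N` its values are `N`-fixed (`n·ψ(u) = ψ(nu) = ψ(u·u⁻¹nu) = ψ(u)`), hence killed by
`C` (the inflation–restriction sequence `0 → H¹(U/N, X^N) → H¹(U, X) → H¹(N, X)`, in the form
"the kernel of `res` is killed by whatever kills `X^N`").
[cite: SerreGaloisCohomology1997, I §2.6 (b)] [cite: NeukirchSchmidtWingberg2008, (1.6.7)] -/
theorem smul_eq_zero_of_resLe_eq_zero (hX : ∀ v : X, Continuous fun g : G => X.ρ g v)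
    {N U : Subgroup G} [N.Normal] (h : N ≤ U) (C : R)
    (hC : ∀ v : X, (∀ n ∈ N, X.ρ n v = v) → C • v = 0)
    (ξ : continuousCohomology 1 (subgroupRep X U)) (hξ : resLe X h 1 ξ = 0) : C • ξ = 0 := by
  obtain ⟨φ, rfl⟩ := oneCocycleClass_surjective _ ξ
  rw [resLe_oneCocycleClass, oneCocycleClass_eq_zero_iff] at hξ
  obtain ⟨v, hv⟩ := hξ
  -- the coboundary `∂v` on `U`
  let cob : contOneCocycles (subgroupRep X U) :=
    ⟨⟨fun u => X.ρ (u : G) v - v, ((hX v).comp continuous_subtype_val).sub continuous_const⟩,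
      fun a b => by
        change X.ρ ((a : G) * b) v - v =
          (X.ρ (a : G) v - v) + (subgroupRep X U).ρ a (X.ρ (b : G) v - v)
        rw [subgroupRep_ρ_apply, map_sub, ρ_mul_apply]
        abel⟩
  have hcob : oneCocycleClass _ cob = 0 := (oneCocycleClass_eq_zero_iff _ cob).mpr ⟨v, fun u => rfl⟩
  set ψ := φ - cob with hψ
  -- `ψ` vanishes on `N`
  have hψN : ∀ n : G, ∀ hn : n ∈ N, ∀ hnU : n ∈ U, ψ.1 ⟨n, hnU⟩ = 0 := by
    intro n hn hnU
    have h1 := hv ⟨n, hn⟩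
    rw [contOneCocycles.pullback_apply, TopRep.hom_ofHom] at h1
    change φ.1 ⟨n, h hn⟩ = X.ρ n v - v at h1
    change φ.1 ⟨n, hnU⟩ - (X.ρ n v - v) = 0
    rw [h1, sub_self]
  -- the values of `ψ` are `N`-fixed
  have hfix : ∀ u : U, ∀ n ∈ N, X.ρ n (ψ.1 u) = ψ.1 u := by
    intro u n hn
    have hnU : n ∈ U := h hn
    have hm : (u : G)⁻¹ * n * u ∈ N := Subgroup.Normal.conj_mem' inferInstance n hn (u : G)
    have h1 := ψ.2 ⟨n, hnU⟩ u
    have h2 := ψ.2 u ⟨(u : G)⁻¹ * n * u, h hm⟩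
    rw [hψN n hn hnU, zero_add] at h1
    rw [hψN _ hm (h hm), map_zero, add_zero] at h2
    have heq : (⟨n, hnU⟩ : U) * u = u * ⟨(u : G)⁻¹ * n * u, h hm⟩ :=
      Subtype.ext (by simp [mul_assoc])
    rw [heq, h2] at h1
    exact h1.symm
  have hCψ : C • ψ = 0 := Subtype.ext (ContinuousMap.ext fun u => by
    rw [Submodule.coe_smul, ContinuousMap.smul_apply, Submodule.coe_zero, ContinuousMap.zero_apply]
    exact hC _ (hfix u))
  have hcls : oneCocycleClass _ φ = oneCocycleClass _ ψ := by
    rw [hψ, oneCocycleClass_sub, hcob, sub_zero]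
  rw [hcls, ← oneCocycleClass_smul, hCψ, oneCocycleClass_zero]

end InfRes

section TorsionBound

variable {p} (W : WeierstrassCurve ℚ) [W.IsElliptic] (κ : ZpExtension ℚ p)

/-- **A uniform exponent killing all fixed torsion up the tower**: there is `c` with
`p^c · v = 0` for every `v ∈ W[p^k]` fixed by `Γ_m = Gal(ℚ̄/ℚ_m)`, for all `k`, `m` — because every
such `v` lies in the FINITE group `E[p^∞]^{Gal(ℚ̄/ℚ_∞)} = E(ℚ_∞)[p^∞]`
(`WeierstrassCurve.finite_fixedPoints_kerSubgroup_geomPrimaryTorsion_rat`, Greenberg LNM 1716 §1 /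
Imai / Ribet, proved in the tree for every `E/ℚ`, `p`, `ℤ_p`-extension).
[cite: GreenbergLNM1716, §1 p. 62 and §3 p. 86] -/
theorem exists_pow_smul_eq_zero_of_forall_smul_eq :
    ∃ c : ℕ, ∀ (k m : ℕ) (v : geomTorsion W ((p : ℤ) ^ k)),
      (∀ g ∈ κ.layerSubgroup m, g • v = v) → p ^ c • v = 0 := by
  classical
  haveI := W.finite_fixedPoints_kerSubgroup_geomPrimaryTorsion_rat κ (p := p)
  set B := FixedPoints.addSubgroup κ.kerSubgroup (geomPrimaryTorsion W p) with hB
  have hord : ∀ b : B, ∃ n : ℕ, p ^ n • ((b : geomPrimaryTorsion W p) : geomPoints W) = 0 :=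
    fun b => AddCommGroup.mem_primaryComponent.mp (b : geomPrimaryTorsion W p).2
  choose nb hnb using hord
  haveI : Fintype B := Fintype.ofFinite B
  refine ⟨∑ b, nb b, fun k m v hv => ?_⟩
  have hvP : (v : geomPoints W) ∈ geomPrimaryTorsion W p := by
    refine AddCommGroup.mem_primaryComponent.mpr ⟨k, ?_⟩
    have h := (Submodule.mem_torsionBy_iff _ _).mp v.2
    rwa [← natCast_zsmul, Nat.cast_pow]
  have hfixed : (⟨(v : geomPoints W), hvP⟩ : geomPrimaryTorsion W p) ∈ B := by
    rw [hB, FixedPoints.mem_addSubgroup]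
    intro τ
    apply Subtype.ext
    rw [Subgroup.mk_smul, primaryComponent.coe_smul]
    change (τ : absoluteGaloisGroup ℚ) • (v : geomPoints W) = v
    rw [← AddSubgroup.torsionBy.coe_smul, hv _ (κ.kerSubgroup_le_layerSubgroup m τ.2)]
  have hkill := hnb ⟨_, hfixed⟩
  have hle : nb ⟨_, hfixed⟩ ≤ ∑ b, nb b :=
    Finset.single_le_sum (fun b _ => Nat.zero_le (nb b)) (Finset.mem_univ _)
  apply Subtype.ext
  rw [AddSubmonoidClass.coe_nsmul, ZeroMemClass.coe_zero, ← Nat.add_sub_cancel' hle, pow_add,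
    mul_comm, ← smul_smul]
  change p ^ (∑ b, nb b - nb ⟨_, hfixed⟩) •
    p ^ nb ⟨_, hfixed⟩ • (((⟨_, hfixed⟩ : B) : geomPrimaryTorsion W p) : geomPoints W) = 0
  rw [hkill, smul_zero]

end TorsionBound

end IwasawaH1LayerNorm

end Literature.NumberTheory.EllipticCurves.Kato2004

end
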